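import Literature.MathematicalPhysics.QuantumLattice.HubbardDressedClusterTorusEnergy
import Literature.MathematicalPhysics.QuantumLattice.HubbardTorusTTPrimeClusterEnergyRepresentative
import HarnessLib

/-!
# The energy of the seam-dressed cluster trial state on the torus is `K_x K_y` times the per-box functional

Topic `Literature/MathematicalPhysics/QuantumLattice` (namespace = path; family `hubbard`). For the trial state
`ρ' = W (Π_v Γ_{box v} σ) Wᴴ` of certificate **C3** on the square torus `L = K_x a = K_y b` (`K_x, K_y ≥ 9`):

  `Re tr(ρ' · H^{tt'U}_L) = K_x K_y · SeamDressed.boxEnergy … t t' U`   (`re_trace_trialState_mul_hubbardTorusTT'`).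

Proof: the torus Hamiltonian is a sum over sites `w` of on-site doublons and of the nearest-neighbour / diagonal
bonds issuing from `w` (`hubbardTorus_eq_kinetic_bond_sum`, `diagHamiltonian_eq_kinetic_bond_sum`); site sums over the
torus are sums over boxes and box sites (`sum_torusSite_eq_sum_boxes`); a term issuing from the site `(y + z(v)) mod L`
is the box translate `T_{z(v)}` of the term issuing from `y mod L`, and `ρ'` is box-translation invariant, so every
box contributes the same; finally each term issuing from a reference-box site `x` is a placed local term
(`torusDoubleOcc_proj`, `torusBondKinetic_proj`, `torusDiagBondKinetic_proj`), whose expectation is `locE`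
(`trace_trialState_mul_fermionEmbed_window`).

Everything is PROVED; no definition, no named fact.

## References

* Xu et al., Science 384 (2024) eadh7691, eq. (1). [cite: XuEtAl2024, eq. (1)]
* M. Kliesch, C. Gogolin, M. J. Kastoryano, A. Riera, J. Eisert, Phys. Rev. X 4 (2014) 031019, §II. [cite: KlieschEtAl2014, §II]
* S. Friedli, Y. Velenik, *Statistical Mechanics of Lattice Systems* (2017), §3.1. [cite: FriedliVelenik2017, §3.1]
-/

noncomputable section

namespace Literature.MathematicalPhysics.QuantumLattice

open Matrix Finset HubbardWave0 Literature.Probability.LatticeModels AndersonCluster ThermodynamicLimit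
open scoped ComplexOrder BigOperators

namespace SeamDressed

section EnergySum

variable (a b : ℕ) [NeZero a] [NeZero b] (L : ℕ) [NeZero L] {Kx Ky : ℕ} [NeZero Kx] [NeZero Ky]
  (hLx : (L : ℤ) = Kx * a) (hLy : (L : ℤ) = Ky * b)
  {m : ℕ} (G : Fin m → Finset (Site 2)) (hG : ∀ g, G g ⊆ gateRange a b) (hK3 : 3 ≤ Kx ∧ 3 ≤ Ky) (hK : 9 ≤ Kx ∧ 9 ≤ Ky)
  (hsep : ∀ g g', ∀ x ∈ G g, ∀ x' ∈ G g', ((a : ℤ) ∣ x' 0 - x 0) → ((b : ℤ) ∣ x' 1 - x 1) → g = g' ∧ x = x')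
  (u : ∀ g, FermionOp (G g)) (hu : ∀ g, parityAut (u g) = u g) (huU : ∀ g, (u g)ᴴ * u g = 1)
  (σ : FermionOp (rectWindow a b)) (hσ : parityAut σ = σ) (hσtr : σ.trace = 1)

/-- (Local to this file.) Equality of torus sites is decided through the linear order — the instance the generic
Jordan–Wigner lemmas carry. [folklore] -/
noncomputable local instance (priority := high) instDecidableEqFermionTorusSeamDressedSum : DecidableEq (FermionTorus 2 L) :=
  LinearOrder.toDecidableEq

/-! #### Periodicity of the torus terms -/

omit [NeZero a] [NeZero b] [NeZero Kx] [NeZero Ky] in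
/-- `K_{w+c, i} = T_c K_{w,i}`. [cite: XuEtAl2024, eq. (1)] -/
theorem torusBondKinetic_add (w c : TorusSite 2 L) (i : Fin 2) :
    torusBondKinetic (w + c) i = relabel (Orb.translate c) (torusBondKinetic w i) := by
  rw [torusBondKinetic, torusBondKinetic, relabel_sum]
  refine Finset.sum_congr rfl fun s _ => ?_
  rw [relabel_add, relabel_mul, relabel_mul, relabel_translate_creation, relabel_translate_annihilation,
    relabel_translate_creation, relabel_translate_annihilation, add_right_comm w c (Pi.single i 1)]

omit [NeZero a] [NeZero b] [NeZero Kx] [NeZero Ky] in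
/-- `D_{w+c} = T_c D_w`. [cite: XuEtAl2024, eq. (1)] -/
theorem torusDoubleOcc_add (w c : TorusSite 2 L) :
    torusDoubleOcc (w + c) = relabel (Orb.translate c) (torusDoubleOcc w) := by
  rw [torusDoubleOcc, torusDoubleOcc, relabel_mul, relabel_translate_numberOp, relabel_translate_numberOp]

omit [NeZero a] [NeZero b] [NeZero Kx] [NeZero Ky] in
/-- `K^{diag}_{w+c, s} = T_c K^{diag}_{w,s}`. [cite: XuEtAl2024, eq. (1)] -/
theorem torusDiagBondKinetic_add (w c : TorusSite 2 L) (s : Fin 2) :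
    torusDiagBondKinetic (w + c) s = relabel (Orb.translate c) (torusDiagBondKinetic w s) :=
  (relabel_translate_torusDiagBondKinetic c w s).symm

/-! #### The torus terms issuing from a reference-box site are placed local terms -/

omit [NeZero Kx] [NeZero Ky] in
/-- The five term supports issuing from a box site lie in the gate range `[−a,2a)×[−b,2b)`. [cite: FriedliVelenik2017, §3.1] -/
theorem pair_subset_gateRange {x : Site 2} (hx : x ∈ rectWindow a b) (e : Site 2) (he0 : 0 ≤ e 0 ∧ e 0 ≤ 1)
    (he1 : -1 ≤ e 1 ∧ e 1 ≤ 1) : ({x, x + e} : Finset (Site 2)) ⊆ gateRange a b := by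
  have ha : (1 : ℤ) ≤ a := by exact_mod_cast Nat.pos_of_ne_zero (NeZero.ne a)
  have hb : (1 : ℤ) ≤ b := by exact_mod_cast Nat.pos_of_ne_zero (NeZero.ne b)
  rw [mem_rectWindow_iff] at hx
  intro y hy
  rw [gateRange, mem_shiftSet, mem_rectWindow_iff]
  have e0 : (y - -latticeVec a b (1, 1)) 0 = y 0 + a := by simp [latticeVec]
  have e1 : (y - -latticeVec a b (1, 1)) 1 = y 1 + b := by simp [latticeVec]
  rw [e0, e1]
  push_cast
  rcases Finset.mem_insert.1 hy with rfl | hy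
  · refine ⟨⟨by linarith [hx.1.1], by linarith [hx.1.2]⟩, by linarith [hx.2.1], by linarith [hx.2.2]⟩
  · rw [Finset.mem_singleton] at hy
    subst hy
    simp only [Pi.add_apply]
    refine ⟨⟨by linarith [hx.1.1], by linarith [hx.1.2]⟩, by linarith [hx.2.1], by linarith [hx.2.2]⟩

omit [NeZero Kx] [NeZero Ky] in
/-- The singleton support lies in the gate range. [cite: FriedliVelenik2017, §3.1] -/
theorem singleton_subset_gateRange {x : Site 2} (hx : x ∈ rectWindow a b) : ({x} : Finset (Site 2)) ⊆ gateRange a b := by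
  have h := pair_subset_gateRange a b hx 0 ⟨le_rfl, zero_le_one⟩ ⟨by norm_num, zero_le_one⟩
  exact fun y hy => h (Finset.mem_insert.2 (Or.inl (Finset.mem_singleton.1 hy)))

omit [NeZero a] [NeZero b] [NeZero L] [NeZero Kx] [NeZero Ky] in
/-- `proj (unitVec i) = e_i` on the torus. [cite: FriedliVelenik2017, §3.1] -/
theorem proj_unitVec (i : Fin 2) : Torus.proj L (unitVec i : Site 2) = Pi.single i 1 := by
  funext j
  by_cases h : j = i
  · subst h; simp [Torus.proj]
  · simp [Torus.proj, h]

omit [NeZero a] [NeZero b] [NeZero L] [NeZero Kx] [NeZero Ky] in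
/-- `proj (e₀ + e₁) = j₀`, the first diagonal jump of the torus. [cite: XuEtAl2024, eq. (1)] -/
theorem proj_diag_zero : Torus.proj L ((unitVec 0 : Site 2) + unitVec 1) = torusDiagJump L 0 := by
  funext j
  fin_cases j <;> simp [Torus.proj, torusDiagJump]

omit [NeZero a] [NeZero b] [NeZero L] [NeZero Kx] [NeZero Ky] in
/-- `proj (e₀ − e₁) = j₁`, the second diagonal jump of the torus. [cite: XuEtAl2024, eq. (1)] -/
theorem proj_diag_one : Torus.proj L ((unitVec 0 : Site 2) + -unitVec 1) = torusDiagJump L 1 := by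
  funext j
  fin_cases j <;> simp [Torus.proj, torusDiagJump]

omit [NeZero Kx] [NeZero Ky] in
/-- **The doublon at a reference-box site is the placed local doublon.** [cite: XuEtAl2024, eq. (1)] -/
theorem torusDoubleOcc_proj {x : Site 2} (hx : x ∈ rectWindow a b) :
    torusDoubleOcc (Torus.proj L x) =
      fermionEmbed ((PolySite.incl (subset_window a b G {x})).trans
        (windowLegT a b L hLx hLy G hG hK {x} (singleton_subset_gateRange a b hx))) (onsitePair x) := by
  rw [onsitePair, map_mul, fermionEmbed_numberOp, fermionEmbed_numberOp, torusDoubleOcc]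
  rfl

omit [NeZero Kx] [NeZero Ky] in
/-- **The density at a reference-box site is the placed local density.** [cite: XuEtAl2024, eq. (1)] -/
theorem torusDensity_proj {x : Site 2} (hx : x ∈ rectWindow a b) :
    torusDensity (Torus.proj L x) =
      fermionEmbed ((PolySite.incl (subset_window a b G {x})).trans
        (windowLegT a b L hLx hLy G hG hK {x} (singleton_subset_gateRange a b hx))) (density x) := by
  rw [density, map_add, fermionEmbed_numberOp, fermionEmbed_numberOp, torusDensity]
  rfl

omit [NeZero Kx] [NeZero Ky] in
/-- **A bond issuing from a reference-box site is the placed local hopping.** [cite: XuEtAl2024, eq. (1)] -/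
theorem hop_proj {x e : Site 2} (hS : ({x, x + e} : Finset (Site 2)) ⊆ gateRange a b) :
    (∑ s : Fin 2, (creation (orb (FermionTorus.ofTorusSite (Torus.proj L x)) s) *
        annihilation (orb (FermionTorus.ofTorusSite (Torus.proj L x + Torus.proj L e)) s) +
      creation (orb (FermionTorus.ofTorusSite (Torus.proj L x + Torus.proj L e)) s) *
        annihilation (orb (FermionTorus.ofTorusSite (Torus.proj L x)) s))) =
      fermionEmbed ((PolySite.incl (subset_window a b G {x, x + e})).trans
        (windowLegT a b L hLx hLy G hG hK {x, x + e} hS)) (hop x (x + e)) := by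
  rw [hop, map_sum]
  refine Finset.sum_congr rfl fun s _ => ?_
  rw [map_add, map_mul, map_mul, fermionEmbed_creation, fermionEmbed_annihilation, fermionEmbed_creation,
    fermionEmbed_annihilation, ← proj_add]
  rfl

/-! #### The per-site terms and their expectations -/

/-- The five terms issuing from the torus site `w` of the `t–t'–U` Hamiltonian: `U D_w − t Σ_i K_{w,i} − t' Σ_s K^{diag}_{w,s}`.
[cite: XuEtAl2024, eq. (1)] -/
def siteTerm (t t' U : ℝ) (w : TorusSite 2 L) : Matrix (Finset (Orb (FermionTorus 2 L))) (Finset (Orb (FermionTorus 2 L))) ℂ :=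
  (U : ℂ) • torusDoubleOcc w - (t : ℂ) • ∑ i : Fin 2, torusBondKinetic w i - (t' : ℂ) • ∑ s : Fin 2, torusDiagBondKinetic w s

omit [NeZero a] [NeZero b] [NeZero Kx] [NeZero Ky] in
/-- The site terms are box-translates of each other: `h_{w+c} = T_c h_w`. [cite: XuEtAl2024, eq. (1)] -/
theorem siteTerm_add (t t' U : ℝ) (w c : TorusSite 2 L) :
    siteTerm L t t' U (w + c) = relabel (Orb.translate c) (siteTerm L t t' U w) := by
  rw [siteTerm, siteTerm, relabel_sub, relabel_sub, relabel_smul, relabel_smul, relabel_smul, relabel_sum, relabel_sum,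
    torusDoubleOcc_add]
  simp_rw [torusBondKinetic_add L w c, torusDiagBondKinetic_add L w c]

omit [NeZero a] [NeZero b] in
/-- **The torus Hamiltonian as the sum of its site terms** (`L ≥ 3`). [cite: XuEtAl2024, eq. (1)] -/
theorem hubbardTorusTT'_eq_sum_siteTerm (t t' U : ℝ) (hL : 3 ≤ L) :
    hubbardTorusTT' L t t' U = ∑ w : TorusSite 2 L, siteTerm L t t' U w := by
  rw [hubbardTorusTT', ← hubbardTorus, hubbardTorus_eq_kinetic_bond_sum t U hL, diagHamiltonian_eq_kinetic_bond_sum t' hL]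
  simp only [siteTerm, Finset.sum_sub_distrib, Finset.smul_sum, neg_smul, Finset.sum_neg_distrib]
  rw [Finset.sum_comm (f := fun i w => (t : ℂ) • torusBondKinetic w i),
    Finset.sum_comm (f := fun s w => (t' : ℂ) • torusDiagBondKinetic w s)]
  abel

include hLx hLy hG hK hsep hu huU hσ hσtr in
/-- **The expectation of the site term at a reference-box site is the local functional.**
[cite: KlieschEtAl2014, §II] [cite: XuEtAl2024, eq. (1)] -/
theorem re_trace_trialState_mul_siteTerm (t t' U : ℝ) {x : Site 2} (hx : x ∈ rectWindow a b) :
    (trialState a b L hLx hLy G hG hK3 hsep u hu σ hσ * siteTerm L t t' U (Torus.proj L x)).trace.re =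
      U * locE a b G hsep u hu σ hσ {x} (onsitePair x)
        - t * (locE a b G hsep u hu σ hσ {x, x + unitVec 0} (hop x (x + unitVec 0))
            + locE a b G hsep u hu σ hσ {x, x + unitVec 1} (hop x (x + unitVec 1)))
        - t' * (locE a b G hsep u hu σ hσ {x, x + unitVec 0 + unitVec 1} (hop x (x + unitVec 0 + unitVec 1))
            + locE a b G hsep u hu σ hσ {x, x + unitVec 0 - unitVec 1} (hop x (x + unitVec 0 - unitVec 1))) := by
  have hred := trace_trialState_mul_fermionEmbed_window a b L hLx hLy G hG hK3 hK hsep u hu huU σ hσ hσtr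
  -- the five supports
  have hS0 : ({x, x + unitVec 0} : Finset (Site 2)) ⊆ gateRange a b :=
    pair_subset_gateRange a b hx _ ⟨by simp, by simp⟩ ⟨by simp, by simp⟩
  have hS1 : ({x, x + unitVec 1} : Finset (Site 2)) ⊆ gateRange a b :=
    pair_subset_gateRange a b hx _ ⟨by simp, by simp⟩ ⟨by simp, by simp⟩
  have hD0 : ({x, x + (unitVec 0 + unitVec 1)} : Finset (Site 2)) ⊆ gateRange a b :=
    pair_subset_gateRange a b hx _ ⟨by simp, by simp⟩ ⟨by simp, by simp⟩
  have hD1 : ({x, x + (unitVec 0 + -unitVec 1)} : Finset (Site 2)) ⊆ gateRange a b :=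
    pair_subset_gateRange a b hx _ ⟨by simp, by simp⟩ ⟨by simp, by simp⟩
  -- the torus terms at `proj x`
  have hK0 : torusBondKinetic (Torus.proj L x) 0 = fermionEmbed ((PolySite.incl (subset_window a b G _)).trans
      (windowLegT a b L hLx hLy G hG hK _ hS0)) (hop x (x + unitVec 0)) := by
    rw [← hop_proj a b L hLx hLy G hG hK hS0, proj_unitVec]; rfl
  have hK1 : torusBondKinetic (Torus.proj L x) 1 = fermionEmbed ((PolySite.incl (subset_window a b G _)).trans
      (windowLegT a b L hLx hLy G hG hK _ hS1)) (hop x (x + unitVec 1)) := by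
    rw [← hop_proj a b L hLx hLy G hG hK hS1, proj_unitVec]; rfl
  have hKd0 : torusDiagBondKinetic (Torus.proj L x) 0 = fermionEmbed ((PolySite.incl (subset_window a b G _)).trans
      (windowLegT a b L hLx hLy G hG hK _ hD0)) (hop x (x + (unitVec 0 + unitVec 1))) := by
    rw [← hop_proj a b L hLx hLy G hG hK hD0, proj_diag_zero]; rfl
  have hKd1 : torusDiagBondKinetic (Torus.proj L x) 1 = fermionEmbed ((PolySite.incl (subset_window a b G _)).trans
      (windowLegT a b L hLx hLy G hG hK _ hD1)) (hop x (x + (unitVec 0 + -unitVec 1))) := by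
    rw [← hop_proj a b L hLx hLy G hG hK hD1, proj_diag_one]; rfl
  rw [siteTerm, Fin.sum_univ_two, Fin.sum_univ_two, hK0, hK1, hKd0, hKd1,
    torusDoubleOcc_proj a b L hLx hLy G hG hK hx]
  simp only [Matrix.mul_sub, Matrix.mul_smul, Matrix.mul_add, Matrix.trace_sub, Matrix.trace_smul, Matrix.trace_add,
    smul_eq_mul, Complex.sub_re, Complex.add_re, Complex.re_ofReal_mul, hred]
  rw [add_assoc x, add_sub_assoc x]
  rfl

include hLx hLy hG hK hsep hu huU hσ hσtr in
/-- **THE ENERGY IDENTITY**: `Re tr(ρ' H^{tt'U}_L) = K_x K_y · boxEnergy`. [cite: KlieschEtAl2014, §II] [cite: XuEtAl2024, eq. (1)] -/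
theorem re_trace_trialState_mul_hubbardTorusTT' (t t' U : ℝ) :
    (trialState a b L hLx hLy G hG hK3 hsep u hu σ hσ * hubbardTorusTT' L t t' U).trace.re =
      ((Kx * Ky : ℕ) : ℝ) * boxEnergy a b G hsep u hu σ hσ t t' U := by
  have hL3 : 3 ≤ L := by
    have ha : (1 : ℤ) ≤ a := by exact_mod_cast Nat.pos_of_ne_zero (NeZero.ne a)
    have hKx : (9 : ℤ) ≤ Kx := by exact_mod_cast hK.1
    have : (3 : ℤ) ≤ L := by rw [hLx]; nlinarith
    exact_mod_cast this
  rw [hubbardTorusTT'_eq_sum_siteTerm L t t' U hL3, Finset.mul_sum, Matrix.trace_sum,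
    sum_torusSite_eq_sum_boxes a b L hLx hLy, Complex.re_sum]
  -- every box contributes the same
  have hper : ∀ (v : Fin Kx × Fin Ky) (y : PolySite (rectWindow a b)),
      (trialState a b L hLx hLy G hG hK3 hsep u hu σ hσ * siteTerm L t t' U (Torus.proj L (ofLex y.1 + boxVec a b v))).trace =
        (trialState a b L hLx hLy G hG hK3 hsep u hu σ hσ * siteTerm L t t' U (Torus.proj L (ofLex y.1))).trace := by
    intro v y
    rw [proj_add, siteTerm_add, trace_trialState_mul_relabel_translate]
  simp_rw [Complex.re_sum, hper]
  rw [Finset.sum_const, Finset.card_univ, Fintype.card_prod, Fintype.card_fin, Fintype.card_fin, nsmul_eq_mul,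
    boxEnergy]
  congr 1
  -- the sum over the reference box
  have hsum : ∀ f : Site 2 → ℝ, ∑ y : PolySite (rectWindow a b), f (ofLex y.1) = ∑ x ∈ rectWindow a b, f x := by
    intro f
    rw [← Finset.sum_coe_sort (rectWindow a b)]
    refine Fintype.sum_equiv ⟨fun y => ⟨ofLex y.1, PolySite.ofLex_mem y⟩, fun x => PolySite.pt x.1 x.2,
      fun y => rfl, fun x => rfl⟩ _ _ fun y => rfl
  rw [← hsum]
  refine Finset.sum_congr rfl fun y _ => ?_
  exact re_trace_trialState_mul_siteTerm a b L hLx hLy G hG hK3 hK hsep u hu huU σ hσ hσtr t t' U (PolySite.ofLex_mem y)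

include hLx hLy hG hK3 hK hsep hu huU hσ hσtr in
/-- **The density identity**: `Σ_x ⟨n_x⟩ = Re tr(σ N)` for number-conserving gates (both sides are `tr(ρ'N)/(K_x K_y)`).
[cite: KlieschEtAl2014, §II] -/
theorem boxDensity_eq_re_trace (huN : ∀ g, Commute totalNumber (u g)) :
    boxDensity a b G hsep u hu σ hσ = (σ * (totalNumber : FermionOp (rectWindow a b))).trace.re := by
  have hL3 : 3 ≤ L := by
    have ha : (1 : ℤ) ≤ a := by exact_mod_cast Nat.pos_of_ne_zero (NeZero.ne a)
    have hKx : (9 : ℤ) ≤ Kx := by exact_mod_cast hK.1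
    have : (3 : ℤ) ≤ L := by rw [hLx]; nlinarith
    exact_mod_cast this
  have hKK : ((Kx * Ky : ℕ) : ℝ) ≠ 0 := by
    have : 0 < Kx * Ky := Nat.mul_pos (by omega) (by omega)
    exact_mod_cast this.ne'
  -- `tr(ρ' N) = K_x K_y tr(σ N)` and `tr(ρ' N) = Σ_w tr(ρ' n_w) = K_x K_y Σ_x ⟨n_x⟩`
  have h1 := trace_trialState_mul_totalNumber a b L hLx hLy G hG hK3 hsep u hu σ hσ huU huN hσtr
  have h2 : (trialState a b L hLx hLy G hG hK3 hsep u hu σ hσ * totalNumber).trace.re =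
      ((Kx * Ky : ℕ) : ℝ) * boxDensity a b G hsep u hu σ hσ := by
    rw [← sum_torusDensity_eq_totalNumber, Finset.mul_sum, Matrix.trace_sum, sum_torusSite_eq_sum_boxes a b L hLx hLy,
      Complex.re_sum]
    have hper : ∀ (v : Fin Kx × Fin Ky) (y : PolySite (rectWindow a b)),
        (trialState a b L hLx hLy G hG hK3 hsep u hu σ hσ * torusDensity (Torus.proj L (ofLex y.1 + boxVec a b v))).trace =
          (trialState a b L hLx hLy G hG hK3 hsep u hu σ hσ * torusDensity (Torus.proj L (ofLex y.1))).trace := by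
      intro v y
      rw [proj_add, show torusDensity (Torus.proj L (ofLex y.1) + Torus.proj L (boxVec a b v)) =
        relabel (Orb.translate (Torus.proj L (boxVec a b v))) (torusDensity (Torus.proj L (ofLex y.1))) from by
          rw [torusDensity, torusDensity, relabel_add, relabel_translate_numberOp, relabel_translate_numberOp],
        trace_trialState_mul_relabel_translate]
    simp_rw [Complex.re_sum, hper]
    rw [Finset.sum_const, Finset.card_univ, Fintype.card_prod, Fintype.card_fin, Fintype.card_fin, nsmul_eq_mul,
      boxDensity]
    congr 1
    have hsum : ∀ f : Site 2 → ℝ, ∑ y : PolySite (rectWindow a b), f (ofLex y.1) = ∑ x ∈ rectWindow a b, f x := by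
      intro f
      rw [← Finset.sum_coe_sort (rectWindow a b)]
      refine Fintype.sum_equiv ⟨fun y => ⟨ofLex y.1, PolySite.ofLex_mem y⟩, fun x => PolySite.pt x.1 x.2,
        fun y => rfl, fun x => rfl⟩ _ _ fun y => rfl
    rw [← hsum]
    refine Finset.sum_congr rfl fun y _ => ?_
    rw [torusDensity_proj a b L hLx hLy G hG hK (PolySite.ofLex_mem y),
      trace_trialState_mul_fermionEmbed_window a b L hLx hLy G hG hK3 hK hsep u hu huU σ hσ hσtr]
    rfl
  have h3 : (trialState a b L hLx hLy G hG hK3 hsep u hu σ hσ * totalNumber).trace.re =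
      ((Kx * Ky : ℕ) : ℝ) * (σ * (totalNumber : FermionOp (rectWindow a b))).trace.re := by
    rw [h1, ← Complex.ofReal_natCast, Complex.re_ofReal_mul]
  have := h2.symm.trans h3
  exact mul_left_cancel₀ hKK this

end EnergySum

end SeamDressed

end Literature.MathematicalPhysics.QuantumLattice

end
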